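import Summits.ValiantsHypothesis.ValiantsHypothesis.Theorems.SymPencilHomogeneousConeKernel
import Summits.ValiantsHypothesis.ValiantsHypothesis.Theorems.SymPencilSdcPerSq

/-!
# Route `SymPencil` — crux `SdcPerBeyondN` (stmt-ValiantsHypothesis-5676):
# `sdc(per_n) ≥ n² + 1` for all `n ≥ 3`

Every SYMMETRIC affine determinantal representation of the permanent `per_n`, `n ≥ 3`, over a
field of characteristic `0` has size `m ≥ n² + 1`: the symmetric model crosses the
number-of-variables wall `N = n²`, for ALL `n` (the tree had `n ≤ 4`,
`SymPencilSdcPerFour.sdcPerBeyondN_of_le_four`).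

Proof (`ne_sq_of_isSymm_isAffineDetRepr_perPoly`, `sq_add_one_le_of_isSymm_isAffineDetRepr_perPoly`).
By `SymPencilSdcPerSq` `m ≥ n²`; suppose `m = n² = N`.  At the Mignon–Ressayre zero `y₀ ≠ 0` of
`per_n` the Hessian is NONDEGENERATE (rank `n² = N`, tree `rank_hessianMatrix_perPoly_mrPoint`)
and `rank A(y₀) = m - 1` (Alper–Bogart–Velasco regularity `le_rank_map_eval_add_one`), so the
cone-kernel theorem `SymPencilHomogeneousConeKernel.rank_constPart_le_two` gives `rank A₀ ≤ 2` for
the constant part `A₀ = A(0)` of the pencil.  But regularity at the origin gives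
`rank A(0) ≥ m - 1 = n² - 1 ≥ 8` — contradiction.  Mechanism in words: with exactly `N` kernel-row
directions available, the kernel-row map `y ↦ M(y) w` has a one-dimensional kernel, which the
nondegenerate Hessian forces to be the cone direction `y₀` itself (Euler), so the kernel of
`A(λ y₀)` is constant along the cone line and `A₀ w = 0`; then the homogeneity identity in the
normal form `0 ⊕ Δ` pins `A₀` down to rank `≤ 2`.

HONEST FRAMING: a `+2` beyond the Hessian bound in a restricted (symmetric) model,
`sdc(per_n) ≥ n² + 1`; the super-quadratic crux `SdcSuperquadratic` is untouched and nothing here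
bears on `VP ≠ VNP`.
-/

noncomputable section

-- single-conjunct layout: Sub = Summit, duplicated namespace component intended
set_option linter.dupNamespace false

namespace Summit.ValiantsHypothesis.ValiantsHypothesis.Theorems.SymPencilSdcPerBeyondN

open Matrix MvPolynomial
open Literature.Computability.AlgebraicComplexity
open Summit.ValiantsHypothesis.ValiantsHypothesis.Theorems.SymPencilHomogeneousConeKernel
open Summit.ValiantsHypothesis.ValiantsHypothesis.Theorems.SymPencilSdcPerSqPred
open Summit.ValiantsHypothesis.ValiantsHypothesis.Theorems.SymPencilSdcPerSq

/-- **No symmetric affine determinantal representation of `per_{m'+3}` has size exactly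
`(m'+3)²`** (characteristic `0`). [folklore] -/
theorem ne_sq_of_isSymm_isAffineDetRepr_perPoly (K : Type*) [Field K] [CharZero K] (m' : ℕ)
    {m : ℕ} {A : Matrix (Fin m) (Fin m) (MvPolynomial (Fin (m' + 3) × Fin (m' + 3)) K)}
    (hS : A.IsSymm) (hA : IsAffineDetRepr (perPoly (Fin (m' + 3)) K) A) : m ≠ (m' + 3) ^ 2 := by
  intro hm
  have hhom : (perPoly (Fin (m' + 3)) K).IsHomogeneous (m' + 3) := by
    simpa using (perPoly_isHomogeneous (n := Fin (m' + 3)) (k := K))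
  -- the Mignon–Ressayre point: a nonzero zero of `per` with nondegenerate Hessian, corank one
  have hx0 : mrPoint K m' ≠ 0 := by
    intro h
    have h1 := congr_fun h ((1 : Fin (m' + 3)), (1 : Fin (m' + 3)))
    simp [mrPoint] at h1
  have hHess : (hessianMatrix (perPoly (Fin (m' + 3)) K) (mrPoint K m')).rank =
      Fintype.card (Fin (m' + 3) × Fin (m' + 3)) := by
    rw [rank_hessianMatrix_perPoly_mrPoint, Fintype.card_prod, Fintype.card_fin, sq]
  have hreg : Fintype.card (Fin m) ≤ (A.map (eval (mrPoint K m'))).rank + 1 := by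
    rw [Fintype.card_fin]
    exact AlperBogartVelasco.le_rank_map_eval_add_one two_ne_zero (by omega) A hA.2 _
  have hN : Fintype.card (Fin (m' + 3) × Fin (m' + 3)) = Fintype.card (Fin m) := by
    rw [Fintype.card_prod, Fintype.card_fin, Fintype.card_fin, hm, sq]
  have h2 := rank_constPart_le_two hhom (by omega) hS hA (mrPoint K m') eval_mrPoint_perPoly hx0
    hHess hreg hN (by rw [Fintype.card_fin]; nlinarith) (by rw [Fintype.card_fin]; nlinarith)
  -- regularity at the origin: `rank A(0) ≥ m - 1`
  have hreg0 := AlperBogartVelasco.le_rank_map_eval_add_one two_ne_zero (by omega) A hA.2 0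
  rw [← constPart_eq_map_eval_zero] at hreg0
  have h9 : 9 ≤ m := by
    rw [hm]
    nlinarith [Nat.zero_le m']
  omega

/-- **`sdc(per_{m'+3}) ≥ (m'+3)² + 1`** over any field of characteristic `0`. [folklore] -/
theorem sq_add_one_le_of_isSymm_isAffineDetRepr_perPoly (K : Type*) [Field K] [CharZero K]
    (m' : ℕ) {m : ℕ} {A : Matrix (Fin m) (Fin m) (MvPolynomial (Fin (m' + 3) × Fin (m' + 3)) K)}
    (hS : A.IsSymm) (hA : IsAffineDetRepr (perPoly (Fin (m' + 3)) K) A) :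
    (m' + 3) ^ 2 + 1 ≤ m := by
  have h1 := sq_le_of_isSymm_isAffineDetRepr_perPoly K m' hS hA
  have h2 := ne_sq_of_isSymm_isAffineDetRepr_perPoly K m' hS hA
  omega

/-- **Crux `SdcPerBeyondN` (stmt-ValiantsHypothesis-5676) — PROVED.** For `n ≥ 3`, every symmetric
affine determinantal representation of `per_n` over `ℂ` has size `≥ n² + 1`. [folklore] -/
theorem sdcPerBeyondN_proof :
    Summit.ValiantsHypothesis.ValiantsHypothesis.Theses.SymPencil.SdcPerBeyondN := by
  unfold Summit.ValiantsHypothesis.ValiantsHypothesis.Theses.SymPencil.SdcPerBeyondN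
  intro n hn m A hS hA
  obtain ⟨m', rfl⟩ : ∃ m', n = m' + 3 := ⟨n - 3, by omega⟩
  exact sq_add_one_le_of_isSymm_isAffineDetRepr_perPoly ℂ m' hS hA

end Summit.ValiantsHypothesis.ValiantsHypothesis.Theorems.SymPencilSdcPerBeyondN

end
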